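import Mathlib
import Summits.ValiantsHypothesis.ValiantsHypothesis.Theorems.NewtonUnitEquationsDissociatedUniformTotalsLawGeneral
import Literature.Computability.AlgebraicComplexity.NewtonPolygonTauProductBounds
import HarnessLib

/-!
# Crux `NewtonUnitEquations.DissociatedUniform` (stmt-ValiantsHypothesis-5905): the union/Minkowski recursion of the totals (memo L1, general `n`)

Companion of `…TotalsLaw` / `…TotalsLawGeneral`.  Memo `Cruxes/DissociatedUniform/NOTES-d1g3.md` §2 L1 in the general
`n`-coordinate vocabulary `TotalsLawN`: splitting the coordinates of an `(m + k)`-coordinate (Q**) design into the first `m`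
(curves `c ∘ Fin.castAdd k`) and the last `k` (curves `c ∘ Fin.natAdd m`), every class is the union over `r ∈ G` of the MINKOWSKI
SUMS of class `r` of the first block and class `s - r` of the second (`classPts_eq_iUnion_add`); a vertex of the hull of a union
is a vertex of its own part and the planar Minkowski vertex bound `V(X + Y) ≤ V(X) + V(Y)`
(`Literature.…KPTT.PlanarMinkowski.ncard_extremePoints_add_le`) give

* `classVert_le_totalVert_add : V_s(c) ≤ T(first block) + T(second block)` (a CLASS bounded by TOTALS of the halves), hence
* `totalVert_le_card_mul_add : T(c) ≤ |G| · (T(first) + T(second))`.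

This is exactly the mechanism that loses one factor `|G|` per halving and yields Theorem Q's `|G|·(2|G|)^{⌈log₂ n⌉}` shape
(`QuasiPoly.ncard_fshadow_le` in frame language); the file records it in class vocabulary so that the place where the GENERAL
totals law `TotalsLawN.TotalsLawGeneral` (typed, OPEN) has to enter is visible by name.  Blocks are assumed nonempty
(`0 < m`, `0 < k`); nothing about the law itself is claimed.
[folklore: vertices of a union / of a planar Minkowski sum]
-/

set_option linter.dupNamespace false -- `ValiantsHypothesis.ValiantsHypothesis` (summit = problem) in every name

open scoped BigOperators Pointwise

namespace Summit.ValiantsHypothesis.ValiantsHypothesis.Theorems.NewtonUnitEquationsDissociatedUniform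

namespace TotalsLawN

variable {G : Type*} [AddCommGroup G] {m k : ℕ}

/-- Splitting a word of length `m + k` into its two blocks: the class `s` of `c` is the union over `r` of the Minkowski sums
`class_r(first block) + class_{s-r}(second block)`. [folklore] -/
theorem classPts_eq_iUnion_add (c : Fin (m + k) → G → (Fin 2 → ℝ)) (s : G) :
    classPts c s = ⋃ r : G, (classPts (fun i => c (Fin.castAdd k i)) r + classPts (fun i => c (Fin.natAdd m i)) (s - r)) := by
  ext p
  simp only [classPts, Set.mem_iUnion, Set.mem_add, Set.mem_range, Subtype.exists, exists_prop]
  constructor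
  · rintro ⟨x, hx, rfl⟩
    refine ⟨∑ i, x (Fin.castAdd k i), _, ⟨fun i => x (Fin.castAdd k i), rfl, rfl⟩, _,
      ⟨fun i => x (Fin.natAdd m i), ?_, rfl⟩, ?_⟩
    · rw [← hx, Fin.sum_univ_add]
      abel
    · rw [Fin.sum_univ_add]
  · rintro ⟨r, _, ⟨xA, hxA, rfl⟩, _, ⟨xB, hxB, rfl⟩, rfl⟩
    refine ⟨Fin.append xA xB, ?_, ?_⟩
    · rw [Fin.sum_univ_add]
      simp only [Fin.append_left, Fin.append_right]
      rw [hxA, hxB]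
      abel
    · rw [Fin.sum_univ_add]
      simp only [Fin.append_left, Fin.append_right]

/-- Classes of a design with at least one coordinate are nonempty (the word `(r, 0, …, 0)`). [folklore] -/
theorem classPts_nonempty (hm : 0 < m) (c : Fin m → G → (Fin 2 → ℝ)) (r : G) : (classPts c r).Nonempty := by
  classical
  refine ⟨_, ⟨⟨fun i => if i = ⟨0, hm⟩ then r else 0, ?_⟩, rfl⟩⟩
  rw [Finset.sum_ite_eq']
  simp

variable [Fintype G]

/-- **Memo L1, general form: a class is bounded by the totals of the two blocks.**
`V_s(c) ≤ T(c ∘ castAdd) + T(c ∘ natAdd)` for an `(m + k)`-coordinate design with both blocks nonempty. [folklore] -/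
theorem classVert_le_totalVert_add (hm : 0 < m) (hk : 0 < k) (c : Fin (m + k) → G → (Fin 2 → ℝ)) (s : G) :
    classVert c s ≤ totalVert (fun i => c (Fin.castAdd k i)) + totalVert (fun i => c (Fin.natAdd m i)) := by
  classical
  set cA : Fin m → G → (Fin 2 → ℝ) := fun i => c (Fin.castAdd k i) with hcA
  set cB : Fin k → G → (Fin 2 → ℝ) := fun i => c (Fin.natAdd m i) with hcB
  -- Finset models of the block classes
  set FA : G → Finset (Fin 2 → ℝ) := fun r =>
    Finset.univ.image fun x : {x : Fin m → G // ∑ j, x j = r} => ∑ j, cA j (x.1 j) with hFA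
  set FB : G → Finset (Fin 2 → ℝ) := fun r =>
    Finset.univ.image fun x : {x : Fin k → G // ∑ j, x j = r} => ∑ j, cB j (x.1 j) with hFB
  have hFAcoe : ∀ r, (FA r : Set (Fin 2 → ℝ)) = classPts cA r := by
    intro r; rw [hFA, Finset.coe_image, Finset.coe_univ, Set.image_univ]; rfl
  have hFBcoe : ∀ r, (FB r : Set (Fin 2 → ℝ)) = classPts cB r := by
    intro r; rw [hFB, Finset.coe_image, Finset.coe_univ, Set.image_univ]; rfl
  have hneA : ∀ r, (FA r).Nonempty := by
    intro r; rw [← Finset.coe_nonempty, hFAcoe]; exact classPts_nonempty hm cA r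
  have hneB : ∀ r, (FB r).Nonempty := by
    intro r; rw [← Finset.coe_nonempty, hFBcoe]; exact classPts_nonempty hk cB r
  set F : G → Finset (Fin 2 → ℝ) := fun r => FA r + FB (s - r) with hF
  have hclass : classPts c s = ((Finset.univ.biUnion F : Finset (Fin 2 → ℝ)) : Set (Fin 2 → ℝ)) := by
    rw [classPts_eq_iUnion_add, Finset.coe_biUnion]
    simp only [Finset.coe_univ, Set.mem_univ, Set.iUnion_true]
    refine Set.iUnion_congr fun r => ?_
    rw [hF]
    dsimp only
    rw [Finset.coe_add, hFAcoe, hFBcoe]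
  unfold classVert
  rw [hclass]
  refine (Literature.Computability.AlgebraicComplexity.KPTT.PlanarMinkowski.ncard_extremePoints_biUnion_le
    Finset.univ F).trans ?_
  have hr : ∀ r, ((convexHull ℝ (F r : Set (Fin 2 → ℝ))).extremePoints ℝ).ncard ≤
      classVert cA r + classVert cB (s - r) := by
    intro r
    refine (Literature.Computability.AlgebraicComplexity.KPTT.PlanarMinkowski.ncard_extremePoints_add_le
      (hneA r) (hneB (s - r))).trans ?_
    unfold classVert
    rw [hFAcoe, hFBcoe]
  calc ∑ r, ((convexHull ℝ (F r : Set (Fin 2 → ℝ))).extremePoints ℝ).ncard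
      ≤ ∑ r, (classVert cA r + classVert cB (s - r)) := Finset.sum_le_sum fun r _ => hr r
    _ = totalVert cA + ∑ r, classVert cB (s - r) := by rw [Finset.sum_add_distrib]; rfl
    _ = totalVert cA + totalVert cB := by
        unfold totalVert
        rw [← Equiv.sum_comp (Equiv.subLeft s) (classVert cB)]
        rfl

/-- **`T(m + k) ≤ |G| · (T(m) + T(k))`** — the totals recursion that loses one factor `|G|` per split (Theorem Q's shape);
feeding it the general totals law instead is the point of `TotalsLawGeneral`. [folklore] -/
theorem totalVert_le_card_mul_add (hm : 0 < m) (hk : 0 < k) (c : Fin (m + k) → G → (Fin 2 → ℝ)) :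
    totalVert c ≤ Fintype.card G *
      (totalVert (fun i => c (Fin.castAdd k i)) + totalVert (fun i => c (Fin.natAdd m i))) := by
  unfold totalVert
  calc ∑ s, classVert c s
      ≤ ∑ _s : G, (totalVert (fun i => c (Fin.castAdd k i)) + totalVert (fun i => c (Fin.natAdd m i))) :=
        Finset.sum_le_sum fun s _ => classVert_le_totalVert_add hm hk c s
    _ = Fintype.card G * (totalVert (fun i => c (Fin.castAdd k i)) + totalVert (fun i => c (Fin.natAdd m i))) := by
        rw [Finset.sum_const, Finset.card_univ, smul_eq_mul]

end TotalsLawN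

end Summit.ValiantsHypothesis.ValiantsHypothesis.Theorems.NewtonUnitEquationsDissociatedUniform
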